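import Literature.MathematicalPhysics.QuantumFieldTheory.Balaban1983to89.Beta.StepJetData
import Literature.MathematicalPhysics.QuantumFieldTheory.Balaban1983to89.Beta.WilsonVertex2Loc

/-!
# The Wilson fine BI-STENCIL family: the two-bond second-order tables on the packed fibre, bi-localised in the consumer's format

HONEST FRAMING (cell `pub-balaban`, β sub-cell, lineage an3; verbatim): discharging `BetaPertH` makes Bałaban's UV stability
UNCONDITIONAL — a real constructive-QFT result; it is NOT the continuum limit and NOT the Clay problem.  This file discharges NOTHING
of `BetaPertH`.  ABSOLUTE RULE of the cell (verbatim): «No internally-minted statement may enter as a cited fact. Every hypothesis is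
either kernel-proved in this package or a verbatim quotation of a PUBLISHED theorem with page reference. The manuscript(s) under audit
are NOT citable for their own disputed steps — they are the thing under adjudication; programme-internal (2001/route/tribunal) claims
are never citable.»  Accordingly every declaration below is a definition or is kernel-proved here from the imports; NOTHING is cited;
no `def … : Prop` occurs at all.

WHAT THIS FILE IS.  The one-step resolvent-kernel calculus (`OneStepResolventKernel`, `StepJetData`, `BalabanCompositeJets`) types a
FINE SECOND-ORDER TABLE as a family `S₂ κ u κ′ u′ : MKer (d+1) (Fib d)` — a kernel on the packed fibre `Fib d = Fin (d+1) ⊕ Fin (d+1)`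
per ORDERED PAIR of fine bonds `(κ, u)`, `(κ′, u′)` — and asks for the certificate
`∀ κ u κ′ u′, BiLoc (S₂ κ u κ′ u′) u u (C · e^{−δ|u′ − u|₁}) δ` (bi-localised at the first bond, constant decaying in the separation;
this is the body of `BalabanCompositeJets.LocStencil₂ S₂ C δ`).  At first order the colourless Wilson stencil was packaged in exactly
this way (`StepJetData.wEntry`, `wilsonS`/`wilsonA`, `locStencil_wilsonA`) from `PlaquetteStencilData`'s alphabet sockets.  This file
is the second-order twin, for a GENERIC position table `T : Fin 4 → Fin 4 → Fin 4 → Fin 4 → ℝ` (the consumer chooses `T`: the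
colour-traced weights `PlaquetteVertex2Trace.w22 N`, one word `WilsonVertex2Kron.stab · · · · w`, or any linear combination — §4):
* §1 `wEntry₂ d T κ u κ′ u′ x z α β := bondPairTab unitVec u κ u′ κ′ T (x, α) (z, β)` (an entry of `WilsonVertex2Kron`'s colourless
  two-bond table on `ℤ^{d+1}` with unit steps) and THE WILSON FINE BI-STENCIL FAMILY `wilsonW₂ d T κ u κ′ u′ : MKer (d+1) (Fib d)`:
  field block `= wEntry₂`, zero on every block touching a multiplier leg; the uniform constant `wBound₂ d T := (d+1)² · tabSum T`
  (`WilsonVertex2Loc.tabSum`, no table value used); `abs_wEntry₂_le`, `abs_wilsonW₂_le`.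
* §2 SUPPORT, from `WilsonVertex2Loc`'s sockets and `StepJetData.l1_isOffset_le`: `wEntry₂ … = 0 ∨ (|x − u|₁ ≤ 2 ∧ |z − u′|₁ ≤ 2 ∧
  |u′ − u|₁ ≤ 2)`; the family VANISHES unless the two bonds are within `ℓ¹`-distance 2 (`wilsonW₂_eq_zero_of_two_lt`: co-plaquette pairs only).
* §3 THE CERTIFICATES, for EVERY rate `δ ≥ 0`: **`biLoc_wilsonW₂ : BiLoc (wilsonW₂ d T κ u κ′ u′) u u (wBound₂ d T · e^{8δ} · e^{−δ|u′−u|₁}) δ`**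
  — literally the body of the consumer's `LocStencil₂ (wilsonW₂ d T) (wBound₂ d T · e^{8δ}) δ` (obtained there as
  `fun κ u κ' u' => biLoc_wilsonW₂ hδ κ u κ' u'`; the `8δ = 2δ + δ·(2 + 4)` pays for centring the column leg at the FIRST bond:
  `|z − u|₁ ≤ |z − u′|₁ + |u′ − u|₁ ≤ 4`, `ExpKernelCalculus.l1_sub_triangle`) — and the two-centre form
  `biLoc_wilsonW₂_pair : BiLoc (wilsonW₂ d T κ u κ′ u′) u u′ (wBound₂ d T · e^{4δ}) δ` (the `VertexFamily₂` shape).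
* §4 STRUCTURE: fine-translation covariance `wilsonW₂ d T κ (u + v) κ′ (u′ + v) = shiftK (−v) (wilsonW₂ d T κ u κ′ u′)`; linearity in
  the table (`wilsonW₂_add`, `wilsonW₂_smul`), so weighted word sums are assembled from the per-word families; block formulas.
* §5 kernel-checked examples (the colour-traced Wilson table `T = w22 N` in the `LocStencil₂` shape; `wBound₂ 3 T = 16 · tabSum T`).

NOT PROVED, NOT CLAIMED: which table `T` (and which colour normalisation relative to the first-order `ad(t_c)`-stripping convention of
`StepJetData` §5) is the physical second-order slot — that is the consumer's bookkeeping; the ORDERED-pair table is shipped as is (only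
`V(p₁,p₂) + V(p₂,p₁)` is intrinsic to the Hessian; no `p₁ ↔ p₂` or leg symmetrisation here); nothing about `vertex2Of`, `KInv`,
`JetData`, summability, any β-coefficient value, `BetaPertH`, `D1Drift`, the RG flow, the continuum limit.  No numerics beyond `(d+1)²`.
-/

open Finset
open scoped BigOperators
open Literature.MathematicalPhysics.QuantumFieldTheory.Balaban1983to89
open Literature.MathematicalPhysics.QuantumFieldTheory.Balaban1983to89.Beta
open B12Sec2to5 (l1 l1_nonneg)
open ExpKernelCalculus (BiLoc shiftK l1_sub_triangle)
open OneStepResolventKernel (Fib)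
open B6BondElimination (unitVec)
open PlaquetteStencilData (IsOffset)
open StepJetData (l1_isOffset_le)
open PlaquetteVertex2Trace (w22)
open WilsonVertex2Kron (bondPairTab bondPairTab_translate bondPairTab_add bondPairTab_smul stab)
open WilsonVertex2Loc (tabSum tabSum_nonneg bondPairTab_apply_ne_zero isOffset_of_bondPairTab_apply_ne_zero abs_bondPairTab_apply_le)

noncomputable section

namespace Literature.MathematicalPhysics.QuantumFieldTheory.Balaban1983to89.Beta.WilsonBiStencil

variable {d : ℕ}

/-! ## §1 The tables on the packed fibre and their uniform bound -/

section Tables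

/-- An ENTRY of the colourless two-bond Wilson table of the position table `T` on `ℤ^{d+1}` (unit steps `unitVec`): ordered bond pair
`(κ, u)`, `(κ′, u′)`, row `(x, α)`, column `(z, β)`.  A definition asserting nothing. [folklore] -/
def wEntry₂ (d : ℕ) (T : Fin 4 → Fin 4 → Fin 4 → Fin 4 → ℝ) (κ : Fin (d + 1)) (u : Fin (d + 1) → ℤ) (κ' : Fin (d + 1))
    (u' : Fin (d + 1) → ℤ) (x z : Fin (d + 1) → ℤ) (α β : Fin (d + 1)) : ℝ :=
  bondPairTab unitVec u κ u' κ' T (x, α) (z, β)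

/-- **THE WILSON FINE BI-STENCIL FAMILY** of the position table `T`: per ordered pair of fine bonds a kernel on the packed fibre
`Fib d = Fin (d+1) ⊕ Fin (d+1)` — the field block is the two-bond table `wEntry₂`, every block touching a multiplier leg is zero (the
shape of `StepJetData.wilsonS` / `wilsonA` at first order).  A definition asserting nothing. [folklore] -/
def wilsonW₂ (d : ℕ) (T : Fin 4 → Fin 4 → Fin 4 → Fin 4 → ℝ) (κ : Fin (d + 1)) (u : Fin (d + 1) → ℤ) (κ' : Fin (d + 1))
    (u' : Fin (d + 1) → ℤ) : ExpKernelCalculus.MKer (d + 1) (Fib d) :=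
  fun x z a b =>
    match a, b with
    | Sum.inl α, Sum.inl β => wEntry₂ d T κ u κ' u' x z α β
    | Sum.inl _, Sum.inr _ => 0
    | Sum.inr _, Sum.inl _ => 0
    | Sum.inr _, Sum.inr _ => 0

/-- THE UNIFORM CONSTANT `(d+1)² · tabSum T` (no table value is used).  A definition asserting nothing. [folklore] -/
def wBound₂ (d : ℕ) (T : Fin 4 → Fin 4 → Fin 4 → Fin 4 → ℝ) : ℝ := ((d : ℝ) + 1) ^ 2 * tabSum T

variable (T : Fin 4 → Fin 4 → Fin 4 → Fin 4 → ℝ)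

/-- `0 ≤ wBound₂ d T`. [folklore] -/
theorem wBound₂_nonneg (d : ℕ) : 0 ≤ wBound₂ d T := mul_nonneg (sq_nonneg _) (tabSum_nonneg T)

/-- The field block of `wilsonW₂` is `wEntry₂`. [folklore] -/
theorem wilsonW₂_inl_inl (κ : Fin (d + 1)) (u : Fin (d + 1) → ℤ) (κ' : Fin (d + 1)) (u' : Fin (d + 1) → ℤ) (x z : Fin (d + 1) → ℤ)
    (α β : Fin (d + 1)) : wilsonW₂ d T κ u κ' u' x z (Sum.inl α) (Sum.inl β) = wEntry₂ d T κ u κ' u' x z α β := rfl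

/-- The field–multiplier block of `wilsonW₂` vanishes. [folklore] -/
theorem wilsonW₂_inl_inr (κ : Fin (d + 1)) (u : Fin (d + 1) → ℤ) (κ' : Fin (d + 1)) (u' : Fin (d + 1) → ℤ) (x z : Fin (d + 1) → ℤ)
    (α β : Fin (d + 1)) : wilsonW₂ d T κ u κ' u' x z (Sum.inl α) (Sum.inr β) = 0 := rfl

/-- The multiplier–field block of `wilsonW₂` vanishes. [folklore] -/
theorem wilsonW₂_inr_inl (κ : Fin (d + 1)) (u : Fin (d + 1) → ℤ) (κ' : Fin (d + 1)) (u' : Fin (d + 1) → ℤ) (x z : Fin (d + 1) → ℤ)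
    (α β : Fin (d + 1)) : wilsonW₂ d T κ u κ' u' x z (Sum.inr α) (Sum.inl β) = 0 := rfl

/-- The multiplier block of `wilsonW₂` vanishes. [folklore] -/
theorem wilsonW₂_inr_inr (κ : Fin (d + 1)) (u : Fin (d + 1) → ℤ) (κ' : Fin (d + 1)) (u' : Fin (d + 1) → ℤ) (x z : Fin (d + 1) → ℤ)
    (α β : Fin (d + 1)) : wilsonW₂ d T κ u κ' u' x z (Sum.inr α) (Sum.inr β) = 0 := rfl

/-- **EVERY ENTRY IS BOUNDED BY `wBound₂ d T`** (from `WilsonVertex2Loc.abs_bondPairTab_apply_le`, `card (Fin (d+1)) = d + 1`). [folklore] -/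
theorem abs_wEntry₂_le (κ : Fin (d + 1)) (u : Fin (d + 1) → ℤ) (κ' : Fin (d + 1)) (u' : Fin (d + 1) → ℤ) (x z : Fin (d + 1) → ℤ)
    (α β : Fin (d + 1)) : |wEntry₂ d T κ u κ' u' x z α β| ≤ wBound₂ d T := by
  have h := abs_bondPairTab_apply_le unitVec u κ u' κ' T (x, α) (z, β)
  rw [Fintype.card_fin, Nat.cast_succ] at h
  exact h

/-- The bound uniformly over the packed fibre. [folklore] -/
theorem abs_wilsonW₂_le (κ : Fin (d + 1)) (u : Fin (d + 1) → ℤ) (κ' : Fin (d + 1)) (u' : Fin (d + 1) → ℤ) (x z : Fin (d + 1) → ℤ)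
    (a b : Fib d) : |wilsonW₂ d T κ u κ' u' x z a b| ≤ wBound₂ d T := by
  rcases a with α | α <;> rcases b with β | β
  · exact abs_wEntry₂_le T κ u κ' u' x z α β
  · show |(0 : ℝ)| ≤ _; rw [abs_zero]; exact wBound₂_nonneg T d
  · show |(0 : ℝ)| ≤ _; rw [abs_zero]; exact wBound₂_nonneg T d
  · show |(0 : ℝ)| ≤ _; rw [abs_zero]; exact wBound₂_nonneg T d

end Tables

/-! ## §2 Support: both legs in the alphabets of their bonds, the bonds co-plaquette -/

section Support

variable (T : Fin 4 → Fin 4 → Fin 4 → Fin 4 → ℝ)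

/-- **FINITE RANGE AND CO-PLAQUETTE SUPPORT IN `ℓ¹`**: an entry vanishes unless the row site lies within `ℓ¹`-distance 2 of the first
bond's site, the column site within 2 of the second bond's site, and the two bond sites within 2 of each other
(`WilsonVertex2Loc.bondPairTab_apply_ne_zero` / `isOffset_of_bondPairTab_apply_ne_zero` + `StepJetData.l1_isOffset_le`). [folklore] -/
theorem wEntry₂_eq_zero_or (κ : Fin (d + 1)) (u : Fin (d + 1) → ℤ) (κ' : Fin (d + 1)) (u' : Fin (d + 1) → ℤ) (x z : Fin (d + 1) → ℤ)
    (α β : Fin (d + 1)) :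
    wEntry₂ d T κ u κ' u' x z α β = 0 ∨ (l1 (x - u) ≤ 2 ∧ l1 (z - u') ≤ 2 ∧ l1 (u' - u) ≤ 2) := by
  by_cases h : wEntry₂ d T κ u κ' u' x z α β = 0
  · exact Or.inl h
  · right
    have h' : bondPairTab unitVec u κ u' κ' T (x, α) (z, β) ≠ 0 := h
    obtain ⟨⟨x₀, hx₀, hx⟩, ⟨z₀, hz₀, hz⟩⟩ := bondPairTab_apply_ne_zero unitVec u κ u' κ' T h'
    have hu := (isOffset_of_bondPairTab_apply_ne_zero unitVec u κ u' κ' T h').1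
    dsimp only at hx hz
    rw [hx, hz, add_sub_cancel_left, add_sub_cancel_left]
    exact ⟨l1_isOffset_le hx₀, l1_isOffset_le hz₀, l1_isOffset_le hu⟩

/-- An entry vanishes when the two bond sites are more than `ℓ¹`-distance 2 apart. [folklore] -/
theorem wEntry₂_eq_zero_of_two_lt {κ : Fin (d + 1)} {u : Fin (d + 1) → ℤ} {κ' : Fin (d + 1)} {u' : Fin (d + 1) → ℤ}
    (h : 2 < l1 (u' - u)) (x z : Fin (d + 1) → ℤ) (α β : Fin (d + 1)) : wEntry₂ d T κ u κ' u' x z α β = 0 := by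
  rcases wEntry₂_eq_zero_or T κ u κ' u' x z α β with h0 | ⟨-, -, hu⟩
  · exact h0
  · exact absurd hu (not_le.2 h)

/-- **THE FAMILY IS SUPPORTED ON CO-PLAQUETTE BOND PAIRS**: `wilsonW₂ d T κ u κ′ u′ = 0` unless `|u′ − u|₁ ≤ 2`. [folklore] -/
theorem wilsonW₂_eq_zero_of_two_lt {κ : Fin (d + 1)} {u : Fin (d + 1) → ℤ} {κ' : Fin (d + 1)} {u' : Fin (d + 1) → ℤ}
    (h : 2 < l1 (u' - u)) : wilsonW₂ d T κ u κ' u' = 0 := by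
  funext x z a b
  rcases a with α | α <;> rcases b with β | β
  · exact wEntry₂_eq_zero_of_two_lt T h x z α β
  · rfl
  · rfl
  · rfl

/-- The column leg seen from the FIRST bond: `|z − u|₁ ≤ 4` on the support. [folklore] -/
theorem l1_col_sub_fst_le {u u' z : Fin (d + 1) → ℤ} (hz : l1 (z - u') ≤ 2) (hu : l1 (u' - u) ≤ 2) : l1 (z - u) ≤ 4 :=
  (l1_sub_triangle z u' u).trans (by linarith)

end Support

/-! ## §3 The bi-localisation certificates -/

section Certificates

variable (T : Fin 4 → Fin 4 → Fin 4 → Fin 4 → ℝ)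

/-- ENTRY BOUND IN THE CONSUMER'S `LocStencil₂` SHAPE for any rate `δ ≥ 0`: centred at the first bond `u` for BOTH legs, with the
separation factor `e^{−δ|u′ − u|₁}`; finite range ⇒ the factor `e^{8δ}` (`2δ` for the separation, `δ·(2 + 4)` for the legs). [folklore] -/
theorem abs_wEntry₂_le_exp {δ : ℝ} (hδ : 0 ≤ δ) (κ : Fin (d + 1)) (u : Fin (d + 1) → ℤ) (κ' : Fin (d + 1)) (u' : Fin (d + 1) → ℤ)
    (x z : Fin (d + 1) → ℤ) (α β : Fin (d + 1)) :
    |wEntry₂ d T κ u κ' u' x z α β| ≤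
      wBound₂ d T * Real.exp (8 * δ) * Real.exp (-δ * l1 (u' - u)) * Real.exp (-δ * (l1 (x - u) + l1 (z - u))) := by
  rcases wEntry₂_eq_zero_or T κ u κ' u' x z α β with h | ⟨hx, hz, hu⟩
  · rw [h, abs_zero]
    exact mul_nonneg (mul_nonneg (mul_nonneg (wBound₂_nonneg T d) (Real.exp_pos _).le) (Real.exp_pos _).le) (Real.exp_pos _).le
  · have hzu : l1 (z - u) ≤ 4 := l1_col_sub_fst_le hz hu
    have ha := mul_nonneg hδ (sub_nonneg.2 hx)
    have hb := mul_nonneg hδ (sub_nonneg.2 hu)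
    have hc := mul_nonneg hδ (sub_nonneg.2 hzu)
    have h1 : 1 ≤ Real.exp (8 * δ) * Real.exp (-δ * l1 (u' - u)) * Real.exp (-δ * (l1 (x - u) + l1 (z - u))) := by
      rw [← Real.exp_add, ← Real.exp_add]
      exact Real.one_le_exp (by nlinarith [ha, hb, hc])
    calc |wEntry₂ d T κ u κ' u' x z α β| ≤ wBound₂ d T * 1 := by rw [mul_one]; exact abs_wEntry₂_le T κ u κ' u' x z α β
      _ ≤ wBound₂ d T * (Real.exp (8 * δ) * Real.exp (-δ * l1 (u' - u)) * Real.exp (-δ * (l1 (x - u) + l1 (z - u)))) :=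
          mul_le_mul_of_nonneg_left h1 (wBound₂_nonneg T d)
      _ = _ := by ring

/-- ENTRY BOUND IN THE TWO-CENTRE SHAPE (row leg at the first bond, column leg at the second) for any rate `δ ≥ 0`, factor `e^{4δ}`. [folklore] -/
theorem abs_wEntry₂_le_exp_pair {δ : ℝ} (hδ : 0 ≤ δ) (κ : Fin (d + 1)) (u : Fin (d + 1) → ℤ) (κ' : Fin (d + 1))
    (u' : Fin (d + 1) → ℤ) (x z : Fin (d + 1) → ℤ) (α β : Fin (d + 1)) :
    |wEntry₂ d T κ u κ' u' x z α β| ≤ wBound₂ d T * Real.exp (4 * δ) * Real.exp (-δ * (l1 (x - u) + l1 (z - u'))) := by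
  rcases wEntry₂_eq_zero_or T κ u κ' u' x z α β with h | ⟨hx, hz, -⟩
  · rw [h, abs_zero]
    exact mul_nonneg (mul_nonneg (wBound₂_nonneg T d) (Real.exp_pos _).le) (Real.exp_pos _).le
  · have h1 : 1 ≤ Real.exp (4 * δ) * Real.exp (-δ * (l1 (x - u) + l1 (z - u'))) := by
      rw [← Real.exp_add]
      exact Real.one_le_exp (by nlinarith [mul_nonneg hδ (sub_nonneg.2 hx), mul_nonneg hδ (sub_nonneg.2 hz)])
    calc |wEntry₂ d T κ u κ' u' x z α β| ≤ wBound₂ d T * 1 := by rw [mul_one]; exact abs_wEntry₂_le T κ u κ' u' x z α β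
      _ ≤ wBound₂ d T * (Real.exp (4 * δ) * Real.exp (-δ * (l1 (x - u) + l1 (z - u')))) :=
          mul_le_mul_of_nonneg_left h1 (wBound₂_nonneg T d)
      _ = _ := by ring

/-- **THE WILSON FINE BI-STENCIL FAMILY IS BI-LOCALISED AT ITS FIRST BOND, WITH A CONSTANT DECAYING IN THE BOND SEPARATION**, for
every rate `δ ≥ 0`: `BiLoc (wilsonW₂ d T κ u κ′ u′) u u (wBound₂ d T · e^{8δ} · e^{−δ|u′−u|₁}) δ` — literally the body of the
consumer's `BalabanCompositeJets.LocStencil₂ (wilsonW₂ d T) (wBound₂ d T · e^{8δ}) δ`, which is therefore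
`fun κ u κ' u' => biLoc_wilsonW₂ T hδ κ u κ' u'` on the consumer's side. [folklore] -/
theorem biLoc_wilsonW₂ {δ : ℝ} (hδ : 0 ≤ δ) (κ : Fin (d + 1)) (u : Fin (d + 1) → ℤ) (κ' : Fin (d + 1)) (u' : Fin (d + 1) → ℤ) :
    BiLoc (wilsonW₂ d T κ u κ' u') u u (wBound₂ d T * Real.exp (8 * δ) * Real.exp (-δ * l1 (u' - u))) δ := by
  intro x z a b
  have h0 : |(0 : ℝ)| ≤
      wBound₂ d T * Real.exp (8 * δ) * Real.exp (-δ * l1 (u' - u)) * Real.exp (-δ * (l1 (x - u) + l1 (z - u))) := by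
    rw [abs_zero]
    exact mul_nonneg (mul_nonneg (mul_nonneg (wBound₂_nonneg T d) (Real.exp_pos _).le) (Real.exp_pos _).le) (Real.exp_pos _).le
  rcases a with α | α <;> rcases b with β | β
  · exact abs_wEntry₂_le_exp T hδ κ u κ' u' x z α β
  · exact h0
  · exact h0
  · exact h0

/-- The same certificate quantified over all ordered bond pairs (the consumer's `LocStencil₂ (wilsonW₂ d T) (wBound₂ d T · e^{8δ}) δ`,
unfolded). [folklore] -/
theorem biLoc_wilsonW₂_all {δ : ℝ} (hδ : 0 ≤ δ) :
    ∀ (κ : Fin (d + 1)) (u : Fin (d + 1) → ℤ) (κ' : Fin (d + 1)) (u' : Fin (d + 1) → ℤ),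
      BiLoc (wilsonW₂ d T κ u κ' u') u u (wBound₂ d T * Real.exp (8 * δ) * Real.exp (-δ * l1 (u' - u))) δ :=
  fun κ u κ' u' => biLoc_wilsonW₂ T hδ κ u κ' u'

/-- **THE TWO-CENTRE CERTIFICATE** (row leg at the first bond, column leg at the second; the `VertexFamily₂` shape), for every rate
`δ ≥ 0`: `BiLoc (wilsonW₂ d T κ u κ′ u′) u u′ (wBound₂ d T · e^{4δ}) δ`. [folklore] -/
theorem biLoc_wilsonW₂_pair {δ : ℝ} (hδ : 0 ≤ δ) (κ : Fin (d + 1)) (u : Fin (d + 1) → ℤ) (κ' : Fin (d + 1))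
    (u' : Fin (d + 1) → ℤ) : BiLoc (wilsonW₂ d T κ u κ' u') u u' (wBound₂ d T * Real.exp (4 * δ)) δ := by
  intro x z a b
  have h0 : |(0 : ℝ)| ≤ wBound₂ d T * Real.exp (4 * δ) * Real.exp (-δ * (l1 (x - u) + l1 (z - u'))) := by
    rw [abs_zero]
    exact mul_nonneg (mul_nonneg (wBound₂_nonneg T d) (Real.exp_pos _).le) (Real.exp_pos _).le
  rcases a with α | α <;> rcases b with β | β
  · exact abs_wEntry₂_le_exp_pair T hδ κ u κ' u' x z α β
  · exact h0
  · exact h0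
  · exact h0

end Certificates

/-! ## §4 Structure: fine-translation covariance, linearity in the table -/

section Structure

variable (T : Fin 4 → Fin 4 → Fin 4 → Fin 4 → ℝ)

/-- Translating BOTH bonds translates the entries (`WilsonVertex2Kron.bondPairTab_translate`). [folklore] -/
theorem wEntry₂_translate (κ : Fin (d + 1)) (u : Fin (d + 1) → ℤ) (κ' : Fin (d + 1)) (u' v x z : Fin (d + 1) → ℤ)
    (α β : Fin (d + 1)) : wEntry₂ d T κ (u + v) κ' (u' + v) x z α β = wEntry₂ d T κ u κ' u' (x - v) (z - v) α β := by
  unfold wEntry₂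
  rw [bondPairTab_translate]

/-- **FINE-TRANSLATION COVARIANCE OF THE BI-STENCIL FAMILY**: `wilsonW₂ d T κ (u + v) κ′ (u′ + v) = shiftK (−v) (wilsonW₂ d T κ u κ′ u′)`. [folklore] -/
theorem wilsonW₂_translate (κ : Fin (d + 1)) (u : Fin (d + 1) → ℤ) (κ' : Fin (d + 1)) (u' v : Fin (d + 1) → ℤ) :
    wilsonW₂ d T κ (u + v) κ' (u' + v) = shiftK (-v) (wilsonW₂ d T κ u κ' u') := by
  funext x z a b
  show wilsonW₂ d T κ (u + v) κ' (u' + v) x z a b = wilsonW₂ d T κ u κ' u' (x + -v) (z + -v) a b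
  rcases a with α | α <;> rcases b with β | β
  · show wEntry₂ d T κ (u + v) κ' (u' + v) x z α β = wEntry₂ d T κ u κ' u' (x + -v) (z + -v) α β
    rw [wEntry₂_translate, ← sub_eq_add_neg, ← sub_eq_add_neg]
  · rfl
  · rfl
  · rfl

/-- The entries are ADDITIVE in the table (`WilsonVertex2Kron.bondPairTab_add`). [folklore] -/
theorem wEntry₂_add (T' : Fin 4 → Fin 4 → Fin 4 → Fin 4 → ℝ) (κ : Fin (d + 1)) (u : Fin (d + 1) → ℤ) (κ' : Fin (d + 1))
    (u' x z : Fin (d + 1) → ℤ) (α β : Fin (d + 1)) :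
    wEntry₂ d (T + T') κ u κ' u' x z α β = wEntry₂ d T κ u κ' u' x z α β + wEntry₂ d T' κ u κ' u' x z α β := by
  unfold wEntry₂
  rw [show T + T' = fun i j k l => T i j k l + T' i j k l from rfl, bondPairTab_add, Matrix.add_apply]

/-- The entries are HOMOGENEOUS in the table (`WilsonVertex2Kron.bondPairTab_smul`). [folklore] -/
theorem wEntry₂_smul (r : ℝ) (κ : Fin (d + 1)) (u : Fin (d + 1) → ℤ) (κ' : Fin (d + 1)) (u' x z : Fin (d + 1) → ℤ)
    (α β : Fin (d + 1)) : wEntry₂ d (r • T) κ u κ' u' x z α β = r * wEntry₂ d T κ u κ' u' x z α β := by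
  unfold wEntry₂
  rw [show r • T = fun i j k l => r * T i j k l from rfl, bondPairTab_smul, Matrix.smul_apply, smul_eq_mul]

/-- **THE FAMILY IS ADDITIVE IN THE TABLE**: weighted word sums are assembled from per-word families. [folklore] -/
theorem wilsonW₂_add (T' : Fin 4 → Fin 4 → Fin 4 → Fin 4 → ℝ) (κ : Fin (d + 1)) (u : Fin (d + 1) → ℤ) (κ' : Fin (d + 1))
    (u' : Fin (d + 1) → ℤ) : wilsonW₂ d (T + T') κ u κ' u' = wilsonW₂ d T κ u κ' u' + wilsonW₂ d T' κ u κ' u' := by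
  funext x z a b
  show wilsonW₂ d (T + T') κ u κ' u' x z a b = wilsonW₂ d T κ u κ' u' x z a b + wilsonW₂ d T' κ u κ' u' x z a b
  rcases a with α | α <;> rcases b with β | β
  · exact wEntry₂_add T T' κ u κ' u' x z α β
  · exact (add_zero (0 : ℝ)).symm
  · exact (add_zero (0 : ℝ)).symm
  · exact (add_zero (0 : ℝ)).symm

/-- **THE FAMILY IS HOMOGENEOUS IN THE TABLE**. [folklore] -/
theorem wilsonW₂_smul (r : ℝ) (κ : Fin (d + 1)) (u : Fin (d + 1) → ℤ) (κ' : Fin (d + 1)) (u' : Fin (d + 1) → ℤ) :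
    wilsonW₂ d (r • T) κ u κ' u' = r • wilsonW₂ d T κ u κ' u' := by
  funext x z a b
  show wilsonW₂ d (r • T) κ u κ' u' x z a b = r * wilsonW₂ d T κ u κ' u' x z a b
  rcases a with α | α <;> rcases b with β | β
  · exact wEntry₂_smul T r κ u κ' u' x z α β
  · exact (mul_zero r).symm
  · exact (mul_zero r).symm
  · exact (mul_zero r).symm

end Structure

/-! ## §5 Kernel-checked examples -/

section Examples

/-- The COLOUR-TRACED Wilson table `T = w22 N` (`PlaquetteVertex2Trace.w22`) in the consumer's `LocStencil₂` shape, for every rate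
`δ ≥ 0`, in every dimension. -/
example (N : ℕ) {δ : ℝ} (hδ : 0 ≤ δ) :
    ∀ (κ : Fin (d + 1)) (u : Fin (d + 1) → ℤ) (κ' : Fin (d + 1)) (u' : Fin (d + 1) → ℤ),
      BiLoc (wilsonW₂ d (w22 N) κ u κ' u') u u (wBound₂ d (w22 N) * Real.exp (8 * δ) * Real.exp (-δ * l1 (u' - u))) δ :=
  biLoc_wilsonW₂_all (w22 N) hδ

/-- One colour word `w` (`WilsonVertex2Kron.stab · · · · w`) in the two-centre shape. -/
example (w : Fin 9) {δ : ℝ} (hδ : 0 ≤ δ) (κ : Fin (d + 1)) (u : Fin (d + 1) → ℤ) (κ' : Fin (d + 1)) (u' : Fin (d + 1) → ℤ) :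
    BiLoc (wilsonW₂ d (fun i j k l => stab i j k l w) κ u κ' u') u u' (wBound₂ d (fun i j k l => stab i j k l w) * Real.exp (4 * δ)) δ :=
  biLoc_wilsonW₂_pair _ hδ κ u κ' u'

/-- In dimension `d + 1 = 4` the uniform constant is `16 · tabSum T`. -/
example (T : Fin 4 → Fin 4 → Fin 4 → Fin 4 → ℝ) : wBound₂ 3 T = 16 * tabSum T := by
  norm_num [wBound₂]

/-- At rate `δ = 0` the certificate is the plain uniform bound. -/
example (T : Fin 4 → Fin 4 → Fin 4 → Fin 4 → ℝ) (κ : Fin (d + 1)) (u : Fin (d + 1) → ℤ) (κ' : Fin (d + 1)) (u' : Fin (d + 1) → ℤ) :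
    BiLoc (wilsonW₂ d T κ u κ' u') u u (wBound₂ d T) 0 := by
  have h := biLoc_wilsonW₂ T le_rfl κ u κ' u'
  simp only [mul_zero, zero_mul, neg_zero, Real.exp_zero, mul_one] at h
  exact h

end Examples

end Literature.MathematicalPhysics.QuantumFieldTheory.Balaban1983to89.Beta.WilsonBiStencil

end
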